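import Summits.QuantumFields.QCD.Theses.PauliWegnerSea

/-!
# Crux `GluonicCompletion` (stmt-QuantumFields-9152), line `certified-sea-threshold-graft` — stub `stub_diagonal`

One subsequence for all mass tuples: a locally-`m`-uniform subsequential body above a threshold yields ONE
strictly increasing `φ` along which the body holds for every mass tuple above the threshold (Lindelöf + diagonal).

Notation of this docstring only.  For a regularisation `reg` and a strictly increasing `Θ : ℕ → ℕ`, `reg ∘ Θ` is the
subsequence regularisation (spacings, couplings, volumes, critical masses and `Z_m` precomposed with `Θ`; in the
statements it is spelled out as an anonymous constructor), and `Body (reg ∘ Θ) m` is the matrix of `QCDOf` at the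
mass tuple `m` along it: species renormalisations `z, shift` and OS data `T` with `IsQCDAlong`, non-trivial
non-Gaussian glue, non-decoupled flavour-changing pseudoscalars, and one gap `Δ > 0` of `T` and of the lattice theory.

* `body_transfer` — `Body (reg ∘ Θ) m` sees `Θ` only through its tail and up to reindexing: if `Θ₂ j = Θ₁ (θ j)` for
  all large `j` with `θ → ∞`, then `Body (reg ∘ Θ₁) m → Body (reg ∘ Θ₂) m` (reindex `z, shift` along `θ`; every clause
  reads the scheme through its `k`-th data only — the lattice Schwinger functions definitionally so).
* `exists_diagonal` — the abstract diagonal argument: countably many properties of integer sequences, each reachable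
  from every subsequence by a further extraction and each stable under "is eventually a reindexing of", hold
  simultaneously along one strictly increasing sequence.
* `exists_countable_centres` — Lindelöf: countably many of the boxes `{m | ∀ f, |m f - m₀ f| < ε m₀}`, `m₀` above the
  threshold, cover the open orthant `{m | ∀ f, M₁ < m f}` (`Fin N_f → ℝ` is second countable).
* `stub_diagonal` — assemble.
-/

noncomputable section

namespace Summit.QuantumFields.QCD.Theorems.CertifiedSeaThresholdGraft

open scoped BigOperators Topology
open MeasureTheory Filter Literature.MathematicalPhysics.QuantumFieldTheory
  Literature.MathematicalPhysics.QuantumLattice Literature.Probability.LatticeModels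

/-- **Transfer of the body along eventual reindexings.**  Let `Θ₁, Θ₂ : ℕ → ℕ` be strictly increasing and
suppose `Θ₂ j = Θ₁ (θ j)` for all large `j`, where `θ → ∞`.  If the matrix of `QCDOf` at the mass tuple `m` holds
along the subsequence regularisation `reg ∘ Θ₁` (with renormalisations `z, shift`, OS data `T`, gap `Δ`), then it
holds along `reg ∘ Θ₂` with the reindexed renormalisations `z ∘ θ, shift ∘ θ` and the same `T, Δ`.  Indeed every
clause of `IsQCDAlong` and of `QCDScheme.HasLatticeMassGap` reads the scheme only through its `k`-th data
`(a_k, β_k, L_k, m_f(k), z_s(k), shift_s(k))`: asymptotic scaling and the physical-branch condition are statements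
about `β_k, a_k, m_f(k)`; the `k`-th lattice Schwinger function of `(reg ∘ Θ).scheme m z shift` is DEFINITIONALLY the
`Θ k`-th Schwinger function of `reg.scheme m` with the renormalisations frozen at their `k`-th values; and the
lattice-gap clause at step `k` is a statement about `β_k, L_k, m_f(k), a_k`.  So each clause along `Θ₂` is, for
large `j`, the clause along `Θ₁` at index `θ j`, and `Tendsto.comp` / `Tendsto.eventually` along `θ → ∞` conclude;
the `T`-side clauses do not mention the scheme. [folklore] -/
private theorem body_transfer {Nf : ℕ} (reg : QCDRegularisation Nf) (m : Fin Nf → ℝ) (Θ₁ Θ₂ θ : ℕ → ℕ)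
    (hΘ₁ : StrictMono Θ₁) (hΘ₂ : StrictMono Θ₂) (hθ : Tendsto θ atTop atTop)
    (heq : ∀ᶠ j in atTop, Θ₂ j = Θ₁ (θ j))
    (h : ∃ (z shift : QCDField Nf → ℕ → ℝ) (T : OSData (QCDField Nf) 4), IsQCDAlong ((⟨fun k => reg.a (Θ₁ k), fun k => reg.a_pos (Θ₁ k), reg.tendsto_a.comp (hΘ₁).tendsto_atTop, fun k => reg.β (Θ₁ k), fun k => reg.L (Θ₁ k), reg.tendsto_L.comp (hΘ₁).tendsto_atTop, fun k => reg.mcrit (Θ₁ k), fun k => reg.Zm (Θ₁ k), fun k => reg.Zm_pos (Θ₁ k)⟩ : QCDRegularisation Nf).scheme m z shift) T ∧ T.IsNontrivial QCDField.glue ∧ T.IsNonGaussian QCDField.glue ∧ (∀ f g : Fin Nf, f ≠ g → T.IsNontrivial (QCDField.pseudoRe f g)) ∧ ∃ Δ > 0, T.HasMassGap Δ ∧ ((⟨fun k => reg.a (Θ₁ k), fun k => reg.a_pos (Θ₁ k), reg.tendsto_a.comp (hΘ₁).tendsto_atTop, fun k => reg.β (Θ₁ k), fun k => reg.L (Θ₁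 k), reg.tendsto_L.comp (hΘ₁).tendsto_atTop, fun k => reg.mcrit (Θ₁ k), fun k => reg.Zm (Θ₁ k), fun k => reg.Zm_pos (Θ₁ k)⟩ : QCDRegularisation Nf).scheme m z shift).HasLatticeMassGap Δ) :
    ∃ (z shift : QCDField Nf → ℕ → ℝ) (T : OSData (QCDField Nf) 4), IsQCDAlong ((⟨fun k => reg.a (Θ₂ k), fun k => reg.a_pos (Θ₂ k), reg.tendsto_a.comp (hΘ₂).tendsto_atTop, fun k => reg.β (Θ₂ k), fun k => reg.L (Θ₂ k), reg.tendsto_L.comp (hΘ₂).tendsto_atTop, fun k => reg.mcrit (Θ₂ k), fun k => reg.Zm (Θ₂ k), fun k => reg.Zm_pos (Θ₂ k)⟩ : QCDRegularisation Nf).scheme m z shift) T ∧ T.IsNontrivial QCDField.glue ∧ T.IsNonGaussian QCDField.glue ∧ (∀ f g : Fin Nf, f ≠ g → T.IsNontrivial (QCDField.pseudoRe f g)) ∧ ∃ Δ > 0, T.HasMassGap Δ ∧ ((⟨fun k => reg.a (Θ₂ k), fun k => reg.a_pos (Θ₂ k), reg.tendsto_a.comp (hΘ₂).tendsto_atTop,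 fun k => reg.β (Θ₂ k), fun k => reg.L (Θ₂ k), reg.tendsto_L.comp (hΘ₂).tendsto_atTop, fun k => reg.mcrit (Θ₂ k), fun k => reg.Zm (Θ₂ k), fun k => reg.Zm_pos (Θ₂ k)⟩ : QCDRegularisation Nf).scheme m z shift).HasLatticeMassGap Δ := by
  obtain ⟨z, shift, T, ⟨hAS, hmq, hconv⟩, hNT, hNG, hPS, Δ, hΔ, hgap, hlat⟩ := h
  refine ⟨fun s j => z s (θ j), fun s j => shift s (θ j), T, ⟨?_, ?_, ?_⟩, hNT, hNG, hPS, Δ, hΔ, hgap, ?_⟩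
  · -- asymptotic scaling reads `β_k, a_k`
    obtain ⟨Λ, hΛ, ht⟩ := hAS
    refine ⟨Λ, hΛ, (ht.comp hθ).congr' ?_⟩
    filter_upwards [heq] with j hj
    show reg.β (Θ₁ (θ j)) - afBeta Nf Λ (reg.a (Θ₁ (θ j))) = reg.β (Θ₂ j) - afBeta Nf Λ (reg.a (Θ₂ j))
    rw [hj]
  · -- the physical-branch condition reads `m_f(k)`
    intro fl
    filter_upwards [hθ.eventually (hmq fl), heq] with j hj hj'
    show -1 < reg.mcrit (Θ₂ j) + reg.a (Θ₂ j) * m fl / reg.Zm (Θ₂ j)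
    rw [hj']
    exact hj
  · -- the lattice Schwinger functions read the `k`-th data, definitionally
    intro n hn σ f F hF hoff
    refine ((hconv n hn σ f F hF hoff).comp hθ).congr' ?_
    filter_upwards [heq] with j hj
    show qcdLatticeSchwinger (reg.scheme m (fun s _ => z s (θ j)) (fun s _ => shift s (θ j))) (Θ₁ (θ j)) n σ f =
      qcdLatticeSchwinger (reg.scheme m (fun s _ => z s (θ j)) (fun s _ => shift s (θ j))) (Θ₂ j) n σ f
    rw [hj]
  · -- the lattice-gap clause at step `k` reads `β_k, L_k, m_f(k), a_k`
    intro R R' A B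
    obtain ⟨C, hC⟩ := hlat R R' A B
    refine ⟨C, ?_⟩
    filter_upwards [hθ.eventually hC, heq] with j hj hj'
    show ∀ S : ℕ, reg.L (Θ₂ j) ≤ S → ∀ n : ℕ, n ≤ S →
      ‖qcdLatticeConnectedCorr (reg.β (Θ₂ j)) (2 * S + 1)
          (fun fl => reg.mcrit (Θ₂ j) + reg.a (Θ₂ j) * m fl / reg.Zm (Θ₂ j)) A B n‖ ≤
        C * Real.exp (-(Δ * (reg.a (Θ₂ j) * n)))
    rw [hj']
    exact hj

/-- **The diagonal argument** (abstract form).  Let `P i`, `i : ℕ`, be properties of sequences `ℕ → ℕ` such that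
(1) from every strictly increasing `ψ` and every `i` a further strictly increasing `φ` can be extracted with
`P i (ψ ∘ φ)`, and (2) each `P i` passes from a strictly increasing `Θ₁` to every strictly increasing `Θ₂` that is
eventually a reindexing of it (`Θ₂ j = Θ₁ (θ j)` for large `j`, `θ → ∞`).  Then one strictly increasing `Φ` has
`P i Φ` for all `i`.  Proof: nested extractions `Ψ 0 = id`, `Ψ (i+1) = Ψ i ∘ φᵢ` with `P i (Ψ (i+1))`; the diagonal
`Φ j = Ψ j j` is strictly increasing (`Ψ (j+1) (j+1) = Ψ j (φⱼ (j+1)) > Ψ j j` as `φⱼ (j+1) ≥ j+1`), and for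
`j ≥ i+1` the value `Φ j` lies in the range of `Ψ j ⊆` range of `Ψ (i+1)`, say `Φ j = Ψ (i+1) (θ j)`, with `θ`
strictly increasing there because `Ψ (i+1)` and `Φ` are; so (2) transports `P i` from `Ψ (i+1)` to `Φ`. [folklore] -/
private theorem exists_diagonal {P : ℕ → (ℕ → ℕ) → Prop}
    (hstep : ∀ (i : ℕ) (ψ : ℕ → ℕ), StrictMono ψ → ∃ φ : ℕ → ℕ, StrictMono φ ∧ P i (ψ ∘ φ))
    (hher : ∀ (i : ℕ) (Θ₁ Θ₂ θ : ℕ → ℕ), StrictMono Θ₁ → StrictMono Θ₂ → Tendsto θ atTop atTop →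
      (∀ᶠ j in atTop, Θ₂ j = Θ₁ (θ j)) → P i Θ₁ → P i Θ₂) :
    ∃ Φ : ℕ → ℕ, StrictMono Φ ∧ ∀ i, P i Φ := by
  choose! nxt hmono hP using hstep
  -- the nested extractions `Ψ 0 = id`, `Ψ (i+1) = Ψ i ∘ φᵢ`
  obtain ⟨Ψ, hΨ0, hΨs⟩ : ∃ Ψ : ℕ → ℕ → ℕ, Ψ 0 = id ∧ ∀ i, Ψ (i + 1) = Ψ i ∘ nxt i (Ψ i) :=
    ⟨fun i => Nat.rec id (fun j Ψj => Ψj ∘ nxt j Ψj) i, rfl, fun _ => rfl⟩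
  have hΨmono : ∀ i, StrictMono (Ψ i) := by
    intro i
    induction i with
    | zero => rw [hΨ0]; exact strictMono_id
    | succ i ih => rw [hΨs]; exact ih.comp (hmono i _ ih)
  have hΨP : ∀ i, P i (Ψ (i + 1)) := fun i => by rw [hΨs]; exact hP i _ (hΨmono i)
  -- later extractions take values among earlier ones
  have hrange : ∀ i t n, ∃ n', Ψ (i + t) n = Ψ i n' := by
    intro i t
    induction t with
    | zero => exact fun n => ⟨n, rfl⟩
    | succ t ih =>
        intro n
        obtain ⟨n', hn'⟩ := ih (nxt (i + t) (Ψ (i + t)) n)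
        exact ⟨n', by rw [← add_assoc, hΨs]; exact hn'⟩
  -- the diagonal sequence
  obtain ⟨Φ, hΦdef⟩ : ∃ Φ : ℕ → ℕ, ∀ j, Φ j = Ψ j j := ⟨fun j => Ψ j j, fun _ => rfl⟩
  have hΦ : StrictMono Φ := by
    refine strictMono_nat_of_lt_succ fun j => ?_
    rw [hΦdef, hΦdef, hΨs]
    exact hΨmono j ((Nat.lt_add_one j).trans_le (hmono j _ (hΨmono j)).le_apply)
  refine ⟨Φ, hΦ, fun i => ?_⟩
  -- `Φ` is eventually a reindexing of `Ψ (i+1)`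
  have hex : ∀ t, ∃ n', Ψ (i + 1) n' = Φ (i + 1 + t) := fun t => by
    obtain ⟨n', hn'⟩ := hrange (i + 1) t (i + 1 + t)
    exact ⟨n', by rw [hΦdef]; exact hn'.symm⟩
  choose ϑ hϑ using hex
  have hϑmono : StrictMono ϑ := fun t t' htt' =>
    (hΨmono (i + 1)).lt_iff_lt.1 (by rw [hϑ, hϑ]; exact hΦ (by omega))
  refine hher i (Ψ (i + 1)) Φ (fun j => ϑ (j - (i + 1))) (hΨmono (i + 1)) hΦ
    (hϑmono.tendsto_atTop.comp (tendsto_sub_atTop_nat _)) ?_ (hΨP i)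
  filter_upwards [eventually_ge_atTop (i + 1)] with j hj
  show Φ j = Ψ (i + 1) (ϑ (j - (i + 1)))
  rw [hϑ, Nat.add_sub_cancel' hj]

/-- **Countably many centres suffice** (Lindelöf).  Given radii `ε m₀ > 0` for the tuples `m₀` above the threshold
`M₁`, there is a sequence of centres `c i` above the threshold such that every tuple `m` above the threshold lies in
one of the boxes `{m | ∀ f, |m f - c i f| < ε (c i)}`: these boxes are the open balls of the sup metric on
`Fin N_f → ℝ`, a second-countable space, so countably many of them cover the orthant
(`TopologicalSpace.countable_cover_nhdsWithin`); the countable set (plus the tuple `M₁ + 1`, to make it non-empty)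
is then enumerated. [folklore] -/
private theorem exists_countable_centres {Nf : ℕ} (M₁ : ℝ) (ε : (Fin Nf → ℝ) → ℝ)
    (hε : ∀ m₀ : Fin Nf → ℝ, (∀ f, M₁ < m₀ f) → 0 < ε m₀) :
    ∃ c : ℕ → Fin Nf → ℝ, (∀ i f, M₁ < c i f) ∧
      ∀ m : Fin Nf → ℝ, (∀ f, M₁ < m f) → ∃ i, ∀ f, |m f - c i f| < ε (c i) := by
  obtain ⟨t, htU, htc, hUt⟩ := TopologicalSpace.countable_cover_nhdsWithin
    (s := {m : Fin Nf → ℝ | ∀ f, M₁ < m f}) (f := fun x => Metric.ball x (ε x))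
    fun x hx => mem_nhdsWithin_of_mem_nhds (Metric.ball_mem_nhds x (hε x hx))
  obtain ⟨c, hc⟩ := (htc.insert (fun _ => M₁ + 1 : Fin Nf → ℝ)).exists_eq_range (Set.insert_nonempty _ _)
  refine ⟨c, fun i => ?_, fun m hm => ?_⟩
  · have hci : c i ∈ insert (fun _ => M₁ + 1 : Fin Nf → ℝ) t := by rw [hc]; exact Set.mem_range_self i
    rcases Set.mem_insert_iff.1 hci with h | h
    · rw [h]; exact fun _ => lt_add_one M₁
    · exact htU h
  · have hmU : m ∈ {m : Fin Nf → ℝ | ∀ f, M₁ < m f} := hm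
    obtain ⟨x, hx, hmx⟩ := Set.mem_iUnion₂.1 (hUt hmU)
    have hxc : x ∈ Set.range c := by rw [← hc]; exact Set.mem_insert_of_mem _ hx
    obtain ⟨i, rfl⟩ := hxc
    refine ⟨i, fun f => ?_⟩
    have h := (dist_pi_lt_iff (hε _ (htU hx))).1 (Metric.mem_ball.1 hmx) f
    rwa [Real.dist_eq] at h

/-- **`stub_diagonal` — one subsequence for all mass tuples above the threshold.**  Along a mass-independent
regularisation `reg`, suppose that every mass tuple `m₀` above the threshold `M₁` has a box
`{m | ∀ f, |m f - m₀ f| < ε}` on which, from EVERY subsequence `reg ∘ ψ`, a further subsequence `reg ∘ ψ ∘ φ` can be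
extracted along which the matrix of `QCDOf` (renormalisations, OS data with `IsQCDAlong`, non-triviality clauses,
continuum and lattice gap) holds for all tuples of the box above the threshold simultaneously — the honest output of
a stability-plus-compactness construction.  Then ONE subsequence `reg ∘ φ` carries the matrix of `QCDOf` for every
mass tuple above `M₁` (the shape `QCDOf` demands: one regularisation before `∀ m`).  Proof: countably many boxes
cover the orthant (`exists_countable_centres`, Lindelöf in `Fin N_f → ℝ`); run the diagonal argument
(`exists_diagonal`) on the properties "`Θ` is strictly increasing and the matrix holds along `reg ∘ Θ` on the `i`-th
box", which are reachable by extraction (hypothesis) and stable under eventual reindexing (`body_transfer`: every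
clause reads the scheme through its `k`-th data only). [folklore] -/
theorem stub_diagonal :
    ∀ (Nf : ℕ) (reg : QCDRegularisation Nf) (M₁ : ℝ),
      (∀ m₀ : Fin Nf → ℝ, (∀ f, M₁ < m₀ f) → ∃ ε : ℝ, 0 < ε ∧
        ∀ (ψ : ℕ → ℕ) (hψ : StrictMono ψ), ∃ (φ : ℕ → ℕ) (hφ : StrictMono φ),
          ∀ m : Fin Nf → ℝ, (∀ f, M₁ < m f) → (∀ f, |m f - m₀ f| < ε) →
            ∃ (z shift : QCDField Nf → ℕ → ℝ) (T : OSData (QCDField Nf) 4), IsQCDAlong ((⟨fun k => reg.a (ψ (φ k)), fun k => reg.a_pos (ψ (φ k)), reg.tendsto_a.comp (hψ.comp hφ).tendsto_atTop, fun k => reg.β (ψ (φ k)), fun k => reg.L (ψ (φ k)), reg.tendsto_L.comp (hψ.comp hφ).tendsto_atTop, fun k => reg.mcrit (ψ (φ k)), fun k => reg.Zm (ψ (φ k)), fun k => reg.Zm_pos (ψ (φ k))⟩ : QCDRegularisation Nf).scheme m z shift) T ∧ T.IsNontrivial QCDField.glue ∧ T.IsNonGaussian QCDField.glue ∧ (∀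 f g : Fin Nf, f ≠ g → T.IsNontrivial (QCDField.pseudoRe f g)) ∧ ∃ Δ > 0, T.HasMassGap Δ ∧ ((⟨fun k => reg.a (ψ (φ k)), fun k => reg.a_pos (ψ (φ k)), reg.tendsto_a.comp (hψ.comp hφ).tendsto_atTop, fun k => reg.β (ψ (φ k)), fun k => reg.L (ψ (φ k)), reg.tendsto_L.comp (hψ.comp hφ).tendsto_atTop, fun k => reg.mcrit (ψ (φ k)), fun k => reg.Zm (ψ (φ k)), fun k => reg.Zm_pos (ψ (φ k))⟩ : QCDRegularisation Nf).scheme m z shift).HasLatticeMassGap Δ) →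
      ∃ (φ : ℕ → ℕ) (hφ : StrictMono φ), ∀ m : Fin Nf → ℝ, (∀ f, M₁ < m f) →
        ∃ (z shift : QCDField Nf → ℕ → ℝ) (T : OSData (QCDField Nf) 4), IsQCDAlong ((⟨fun k => reg.a (φ k), fun k => reg.a_pos (φ k), reg.tendsto_a.comp (hφ).tendsto_atTop, fun k => reg.β (φ k), fun k => reg.L (φ k), reg.tendsto_L.comp (hφ).tendsto_atTop, fun k => reg.mcrit (φ k), fun k => reg.Zm (φ k), fun k => reg.Zm_pos (φ k)⟩ : QCDRegularisation Nf).scheme m z shift) T ∧ T.IsNontrivial QCDField.glue ∧ T.IsNonGaussian QCDField.glue ∧ (∀ f g : Fin Nf, f ≠ g → T.IsNontrivial (QCDField.pseudoRe f g)) ∧ ∃ Δ > 0, T.HasMassGap Δ ∧ ((⟨fun k => reg.a (φ k), fun k => reg.a_pos (φ k), reg.tendsto_a.comp (hφ).tendsto_atTop, fun k => reg.β (φ k), fun k => reg.L (φ k), reg.tendsto_L.comp (hφ).tendsto_atTop, fun k => reg.mcrit (φ k), fun k => reg.Zm (φ k), fun k => reg.Zm_pos (φ k)⟩ : QCDRegularisation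 Nf).scheme m z shift).HasLatticeMassGap Δ := by
  intro Nf reg M₁ hyp
  choose! ε hε hH using hyp
  obtain ⟨c, hc, hcov⟩ := exists_countable_centres M₁ ε hε
  obtain ⟨Φ, hΦ, hP⟩ := exists_diagonal
    (P := fun i Θ => ∀ hΘ : StrictMono Θ, ∀ m : Fin Nf → ℝ, (∀ f, M₁ < m f) →
      (∀ f, |m f - c i f| < ε (c i)) → ∃ (z shift : QCDField Nf → ℕ → ℝ) (T : OSData (QCDField Nf) 4), IsQCDAlong ((⟨fun k => reg.a (Θ k), fun k => reg.a_pos (Θ k), reg.tendsto_a.comp (hΘ).tendsto_atTop, fun k => reg.β (Θ k), fun k => reg.L (Θ k), reg.tendsto_L.comp (hΘ).tendsto_atTop, fun k => reg.mcrit (Θ k), fun k => reg.Zm (Θ k), fun k => reg.Zm_pos (Θ k)⟩ : QCDRegularisation Nf).scheme m z shift) T ∧ T.IsNontrivial QCDField.glue ∧ T.IsNonGaussian QCDField.glue ∧ (∀ f g : Fin Nf, f ≠ g → T.IsNontrivial (QCDField.pseudoRe f g)) ∧ ∃ Δ > 0, T.HasMassGap Δ ∧ ((⟨fun k => reg.a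 (Θ k), fun k => reg.a_pos (Θ k), reg.tendsto_a.comp (hΘ).tendsto_atTop, fun k => reg.β (Θ k), fun k => reg.L (Θ k), reg.tendsto_L.comp (hΘ).tendsto_atTop, fun k => reg.mcrit (Θ k), fun k => reg.Zm (Θ k), fun k => reg.Zm_pos (Θ k)⟩ : QCDRegularisation Nf).scheme m z shift).HasLatticeMassGap Δ)
    (fun i ψ hψ => by
      obtain ⟨φ, hφ, h⟩ := hH (c i) (hc i) ψ hψ
      exact ⟨φ, hφ, fun _ m hm hmi => h m hm hmi⟩)
    (fun i Θ₁ Θ₂ θ hΘ₁ _ hθ heq h hΘ₂ m hm hmi =>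
      body_transfer reg m Θ₁ Θ₂ θ hΘ₁ hΘ₂ hθ heq (h hΘ₁ m hm hmi))
  exact ⟨Φ, hΦ, fun m hm => (hcov m hm).elim fun i hi => hP i hΦ m hm hi⟩

end Summit.QuantumFields.QCD.Theorems.CertifiedSeaThresholdGraft

end
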